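import Literature.Computability.FineGrained.IPRenameDict
import HarnessLib

/-!
# The renaming machine of Impagliazzo–Paturi's Lemma 2, XIV: the annotated clause list of a mask

Family `fine-grained` (trunk T-CPLX-FINE). Fourteenth file of the machine half of Impagliazzo–Paturi's Lemma 2: from the clauses and the
dictionary of a mask, the annotated clause list `wAC P F` (`IPRenameTables.lean`) that the clause
driver of `IPRenameDrivers.lean` consumes.

* `litAc` (look the literal's variable up in the dictionary, append its payload to the output),
  `acBody`, `acBuild`; `recHas_map_key` / `recPay_map_key` (lookup in a keyed table);
* the pass (`segRuns_ac_*`: a literal contributes `wALit (annLit P F l)` by `bit_cons_dpay`, a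
  clause its `wAClause`) and **`runs_acBuild`**: `ac := wAC P F`.

## References

* R. Impagliazzo, R. Paturi, *On the complexity of k-SAT*, J. Comput. System Sci. 62 (2001)
  367–375, doi:10.1006/jcss.2000.1727, Lemma 2 (p. 373) and its "Moreover" sentence (the
  reduction is computable within the stated time); pp. 371–372 (`G_x`, `Ψ`, `Θ_i`, `Φ_f`).
  (Not held; acquisition request acq-00143.)
* T. Nipkow, G. Klein, *Concrete Semantics with Isabelle/HOL*, Springer 2014, Ch. 7 (big-step
  reasoning about loops, as in `SymbolPrograms.lean`).
-/

namespace Literature.Computability.FineGrained.IPRenameM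

open _root_.Computability Complexity Complexity.ACom Sparsifier IPRename
open Compaction (uflag uflag_true uflag_false)

/-! ### The annotated clause list of a mask -/

/-- At the comma closing a literal (probe in `pr`, polarity bit already on the output): append the
dictionary payload of its variable to the output `ac2`. [folklore] -/
def litAc : RProg :=
  findRec KR.dict ;; clear (kr KR.fnd) ;; loop (kr KR.key) (fun s => push (kr KR.ac2) s) ;; clear (kr KR.pr)

/-- Body of the annotation pass over the copy `fam2` of the clauses (mode `md` as in `xBody`):
polarity bits and clause ends (as blanks) go to the output, index bits to the probe. [folklore] -/
def acBody (s : Γ') : RProg :=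
  pop (kr KR.md) fun o => match o, s with
    | none, Γ'.bit p => push (kr KR.ac2) (Γ'.bit p) ;; push (kr KR.md) Γ'.blank
    | none, Γ'.ket => push (kr KR.ac2) Γ'.blank
    | none, _ => skip
    | some _, Γ'.bit d => push (kr KR.pr) (Γ'.bit d) ;; push (kr KR.md) Γ'.blank
    | some _, Γ'.comma => litAc
    | some _, _ => skip

/-- **`acBuild`**: the annotated clause list `wAC P F` from the clauses and the dictionary.
[folklore] -/
def acBuild : RProg := copyToG (kr KR.fam) (kr KR.fam2) (kr KR.t1) (kr KR.t2) ;; loop (kr KR.fam2) acBody ;; pour (kr KR.ac2) (kr KR.ac)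

/-- Presence in a keyed table. [folklore] -/
theorem recHas_map_key (f : ℕ → List Γ') (zs : List ℕ) (u : ℕ) : recHas (zs.map fun z => (z, f z)) u = decide (u ∈ zs) := by
  unfold recHas
  rw [List.any_map]
  by_cases h : u ∈ zs
  · rw [decide_eq_true h, List.any_eq_true]; exact ⟨u, h, by simp⟩
  · rw [decide_eq_false h, List.any_eq_false]; intro z hz; simp only [Function.comp_apply, beq_iff_eq]; rintro rfl; exact h hz

/-- Payload in a keyed table. [folklore] -/
theorem recPay_map_key (f : ℕ → List Γ') (zs : List ℕ) (u : ℕ) (h : u ∈ zs) : recPay (zs.map fun z => (z, f z)) u = f u := by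
  unfold recPay
  cases hf : (zs.map fun z => (z, f z)).find? (fun r => r.1 == u) with
  | none =>
    exfalso
    rw [List.find?_eq_none] at hf
    exact hf (u, f u) (List.mem_map.2 ⟨u, h, rfl⟩) (by simp)
  | some r =>
    have := List.find?_some hf
    obtain ⟨z, -, rfl⟩ := List.mem_map.1 (List.mem_of_find?_eq_some hf)
    simp only [beq_iff_eq] at this
    subst this; rfl

/-- Dictionary payloads are blank-free. [folklore] -/
theorem dictRecs_blank_free (P : Params) (F : List (List (ℕ × Bool))) (zs : List ℕ) : ∀ r ∈ dictRecs P F zs, Γ'.blank ∉ r.2 := by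
  intro r hr
  obtain ⟨z, -, rfl⟩ := List.mem_map.1 hr
  unfold dpay; split_ifs <;> simp

/-- The store family `aSt` over a base store. [folklore] -/
def aSt (S : RStore) (fam2 md pr ac2 fnd key : List Γ') : RStore := fun r =>
  if r = kr KR.fam2 then fam2 else if r = kr KR.md then md else if r = kr KR.pr then pr else if r = kr KR.ac2 then ac2 else if r = kr KR.fnd then fnd else if r = kr KR.key then key else S r

section AstLemmas

variable (S : RStore) (fam2 md pr ac2 fnd key w : List Γ')

/-- Reading `fam2`. [folklore] -/
@[simp] theorem aSt_fam2 : aSt S fam2 md pr ac2 fnd key (kr KR.fam2) = fam2 := by simp [aSt]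
/-- Reading `md`. [folklore] -/
@[simp] theorem aSt_md : aSt S fam2 md pr ac2 fnd key (kr KR.md) = md := by simp [aSt]
/-- Reading `pr`. [folklore] -/
@[simp] theorem aSt_pr : aSt S fam2 md pr ac2 fnd key (kr KR.pr) = pr := by simp [aSt]
/-- Reading `ac2`. [folklore] -/
@[simp] theorem aSt_ac2 : aSt S fam2 md pr ac2 fnd key (kr KR.ac2) = ac2 := by simp [aSt]
/-- Reading `fnd`. [folklore] -/
@[simp] theorem aSt_fnd : aSt S fam2 md pr ac2 fnd key (kr KR.fnd) = fnd := by simp [aSt]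
/-- Reading `key`. [folklore] -/
@[simp] theorem aSt_key : aSt S fam2 md pr ac2 fnd key (kr KR.key) = key := by simp [aSt]
/-- Reading any other register. [folklore] -/
theorem aSt_other {r : Reg} (h0 : r ≠ kr KR.fam2) (h1 : r ≠ kr KR.md) (h2 : r ≠ kr KR.pr) (h3 : r ≠ kr KR.ac2) (h4 : r ≠ kr KR.fnd) (h5 : r ≠ kr KR.key) :
    aSt S fam2 md pr ac2 fnd key r = S r := by simp [aSt, h0, h1, h2, h3, h4, h5]
/-- Reading `dict`. [folklore] -/
@[simp] theorem aSt_dict : aSt S fam2 md pr ac2 fnd key (kr KR.dict) = S (kr KR.dict) := by simp [aSt]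
/-- Reading `fam`. [folklore] -/
@[simp] theorem aSt_fam : aSt S fam2 md pr ac2 fnd key (kr KR.fam) = S (kr KR.fam) := by simp [aSt]
/-- Reading `t1`. [folklore] -/
@[simp] theorem aSt_t1 : aSt S fam2 md pr ac2 fnd key (kr KR.t1) = S (kr KR.t1) := by simp [aSt]
/-- Reading `t2`. [folklore] -/
@[simp] theorem aSt_t2 : aSt S fam2 md pr ac2 fnd key (kr KR.t2) = S (kr KR.t2) := by simp [aSt]
/-- Reading `x2`. [folklore] -/
@[simp] theorem aSt_x2 : aSt S fam2 md pr ac2 fnd key (kr KR.x2) = S (kr KR.x2) := by simp [aSt]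
/-- Reading `ac`. [folklore] -/
@[simp] theorem aSt_ac : aSt S fam2 md pr ac2 fnd key (kr KR.ac) = S (kr KR.ac) := by simp [aSt]
/-- Updating `fam2`. [folklore] -/
@[simp] theorem update_aSt_fam2 : Function.update (aSt S fam2 md pr ac2 fnd key) (kr KR.fam2) w = aSt S w md pr ac2 fnd key := by
  funext r; by_cases h : r = kr KR.fam2
  · subst h; simp
  · rw [Function.update_of_ne h]; simp [aSt, h]
/-- Updating `md`. [folklore] -/
@[simp] theorem update_aSt_md : Function.update (aSt S fam2 md pr ac2 fnd key) (kr KR.md) w = aSt S fam2 w pr ac2 fnd key := by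
  funext r; by_cases h : r = kr KR.md
  · subst h; simp
  · rw [Function.update_of_ne h]; simp [aSt, h]
/-- Updating `pr`. [folklore] -/
@[simp] theorem update_aSt_pr : Function.update (aSt S fam2 md pr ac2 fnd key) (kr KR.pr) w = aSt S fam2 md w ac2 fnd key := by
  funext r; by_cases h : r = kr KR.pr
  · subst h; simp
  · rw [Function.update_of_ne h]; simp [aSt, h]
/-- Updating `ac2`. [folklore] -/
@[simp] theorem update_aSt_ac2 : Function.update (aSt S fam2 md pr ac2 fnd key) (kr KR.ac2) w = aSt S fam2 md pr w fnd key := by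
  funext r; by_cases h : r = kr KR.ac2
  · subst h; simp
  · rw [Function.update_of_ne h]; simp [aSt, h]
/-- Updating `fnd`. [folklore] -/
@[simp] theorem update_aSt_fnd : Function.update (aSt S fam2 md pr ac2 fnd key) (kr KR.fnd) w = aSt S fam2 md pr ac2 w key := by
  funext r; by_cases h : r = kr KR.fnd
  · subst h; simp
  · rw [Function.update_of_ne h]; simp [aSt, h]
/-- Updating `key`. [folklore] -/
@[simp] theorem update_aSt_key : Function.update (aSt S fam2 md pr ac2 fnd key) (kr KR.key) w = aSt S fam2 md pr ac2 fnd w := by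
  funext r; by_cases h : r = kr KR.key
  · subst h; simp
  · rw [Function.update_of_ne h]; simp [aSt, h]

end AstLemmas

/-- Every store is a `aSt` over itself. [folklore] -/
theorem aSt_eta (R : RStore) : aSt R (R (kr KR.fam2)) (R (kr KR.md)) (R (kr KR.pr)) (R (kr KR.ac2)) (R (kr KR.fnd)) (R (kr KR.key)) = R := by
  funext r
  by_cases h0 : r = kr KR.fam2; · subst h0; simp
  by_cases h1 : r = kr KR.md; · subst h1; simp
  by_cases h2 : r = kr KR.pr; · subst h2; simp
  by_cases h3 : r = kr KR.ac2; · subst h3; simp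
  by_cases h4 : r = kr KR.fnd; · subst h4; simp
  by_cases h5 : r = kr KR.key; · subst h5; simp
  rw [aSt_other _ _ _ _ _ _ _ h0 h1 h2 h3 h4 h5]

/-- What the annotation pass needs of the base store. [folklore] -/
structure AcBase (S : RStore) (P : Params) (F : List (List (ℕ × Bool))) : Prop where
  /-- the dictionary -/
  dict : S (kr KR.dict) = wRecs (dictRecs P F (occList F))
  /-- the clauses -/
  fam : S (kr KR.fam) = wFam F
  /-- scratch -/
  t1 : S (kr KR.t1) = []
  /-- scratch -/
  t2 : S (kr KR.t2) = []
  /-- scratch -/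
  x2 : S (kr KR.x2) = []
  /-- scratch -/
  vw : S (kr KR.vw) = []
  /-- scratch -/
  ex : S (kr KR.ex) = []
  /-- scratch -/
  eb : S (kr KR.eb) = []
  /-- scratch -/
  lmd : S (kr KR.lmd) = []
  /-- scratch -/
  ne : S (kr KR.ne) = []
  /-- scratch -/
  dict2 : S (kr KR.dict2) = []

/-- The per-symbol budget of the annotation pass. [folklore] -/
def aK (Lo Ld m : ℕ) : ℕ := (12 * Lo + 44) * Ld + 6 * Lo + 3 * m + 60

section AcSpec

variable (S : RStore) (P : Params) (F : List (List (ℕ × Bool))) (hA : AcBase S P F) (Lo : ℕ) (hLo : (wRecs (ocRecs F P.cap (occList F))).length ≤ Lo)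
include hA hLo

/-- **The literal step**: the payload of `x` goes to the output. [folklore] -/
theorem runs_litAc (x : ℕ) (hx : x ∈ occList F) (fam2 ac2 : List Γ') :
    Runs litAc (aSt S fam2 [] (rbits x) ac2 [] []) (aSt S fam2 [] [] ((dpay P F x).reverse ++ ac2) [] [])
      ((12 * Lo + 44) * (wRecs (dictRecs P F (occList F))).length + 5 * Lo + 3 * bsz P + 20) := by
  have hxL : (rbits x).length ≤ Lo := by
    refine le_trans ?_ hLo
    obtain ⟨s₁, s₂, hs⟩ := List.append_of_mem hx
    unfold wRecs ocRecs; rw [hs]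
    simp only [List.map_append, List.map_cons, List.flatMap_append, List.flatMap_cons, List.length_append, List.length_cons, List.length_map, rbits,
      List.length_reverse]
    omega
  have hdp : (dpay P F x).length ≤ Lo + bsz P + 2 := by
    have hocc : (occList F).length ≤ Lo := (length_le_wRecs F P.cap (occList F)).trans hLo
    unfold dpay
    split_ifs with hB
    · have hi : blockOf P F x ≤ Lo := by
        unfold blockOf
        refine (Nat.div_le_self _ _).trans ((List.idxOf_le_length).trans ?_)
        exact (List.length_filter_le _ _).trans hocc
      have hj : posIn P F x < bsz P := Nat.mod_lt _ (bsz_pos P)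
      simp only [List.length_cons, List.length_append, List.length_replicate, List.length_nil]; omega
    · have ha : (encodeNat (newIdxA P F x)).length ≤ Lo := by
        refine (TokConv.length_encodeNat_le _).trans ?_
        unfold newIdxA
        exact (List.idxOf_le_length).trans ((List.length_filter_le _ _).trans hocc)
      simp only [List.length_cons, List.length_append, List.length_map, List.length_nil]; omega
  unfold litAc
  have h1 := runs_findRec' (aSt S fam2 [] (rbits x) ac2 [] []) x KR.dict (by decide) (by decide) (by decide) (by decide) (by decide) (by decide) (by decide)
    (by decide) (by decide) (by decide) (dictRecs P F (occList F)) (dictRecs_blank_free P F _) (by simp [hA.dict]) (by simp)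
    (by rw [aSt_other] <;> simp [hA.x2]) (by simp [hA.t1]) (by simp [hA.t2]) (by rw [aSt_other] <;> simp [hA.dict2]) (by rw [aSt_other] <;> simp [hA.vw])
    (by rw [aSt_other] <;> simp [hA.ex]) (by rw [aSt_other] <;> simp [hA.eb]) (by rw [aSt_other] <;> simp [hA.lmd]) (by simp) (by simp)
    (by rw [aSt_other] <;> simp [hA.ne])
  rw [dictRecs, recHas_map_key, recPay_map_key _ _ _ hx, decide_eq_true hx, update_aSt_fnd, update_aSt_key, ← dictRecs] at h1
  have h2 := runs_clear (kr KR.fnd) (aSt S fam2 [] (rbits x) ac2 (uflag true) (dpay P F x))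
  rw [aSt_fnd, update_aSt_fnd] at h2
  have h3 := runs_moveAll (a := kr KR.key) (b := kr KR.ac2) (by simp) (dpay P F x) (aSt S fam2 [] (rbits x) ac2 [] (dpay P F x)) (by simp)
  rw [aSt_ac2, update_aSt_key, update_aSt_ac2] at h3
  have h4 := runs_clear (kr KR.pr) (aSt S fam2 [] (rbits x) ((dpay P F x).reverse ++ ac2) [] [])
  rw [aSt_pr, update_aSt_pr] at h4
  refine (h1.seq (h2.seq (h3.seq h4))).mono ?_
  have hm : (12 * (rbits x).length + 44) * (wRecs (dictRecs P F (occList F))).length ≤ (12 * Lo + 44) * (wRecs (dictRecs P F (occList F))).length :=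
    Nat.mul_le_mul_right _ (by omega)
  simp only [uflag_true, List.length_singleton]
  omega

omit hA hLo in
/-- Index bits go to `pr` (mode `blank`). [folklore] -/
theorem segRuns_ac_bits (ac2 : List Γ') : ∀ (u : List Bool) (rest pr : List Γ'),
    SegRuns (kr KR.fam2) acBody (u.map Γ'.bit) (aSt S (u.map Γ'.bit ++ rest) [Γ'.blank] pr ac2 [] [])
      (aSt S rest [Γ'.blank] ((u.map Γ'.bit).reverse ++ pr) ac2 [] []) (6 * u.length)
  | [], rest, pr => by simpa using SegRuns.nil (kr KR.fam2) acBody _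
  | d :: u, rest, pr => by
    have hbody : Runs (acBody (Γ'.bit d)) (Function.update (aSt S (Γ'.bit d :: (u.map Γ'.bit ++ rest)) [Γ'.blank] pr ac2 [] []) (kr KR.fam2) (u.map Γ'.bit ++ rest))
        (aSt S (u.map Γ'.bit ++ rest) [Γ'.blank] (Γ'.bit d :: pr) ac2 [] []) (2 + 2) := by
      rw [update_aSt_fam2]; unfold acBody
      refine Runs.pop_cons (k := kr KR.md) (a := Γ'.blank) (w := []) (by simp) ?_
      rw [update_aSt_md]
      exact ((Runs.push' (R' := aSt S (u.map Γ'.bit ++ rest) [] (Γ'.bit d :: pr) ac2 [] []) (by simp)).seq (Runs.push' (by simp))).of_eq rfl (by norm_num)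
    have ih := segRuns_ac_bits ac2 u rest (Γ'.bit d :: pr)
    have hk : aSt S (Γ'.bit d :: (u.map Γ'.bit ++ rest)) [Γ'.blank] pr ac2 [] [] (kr KR.fam2) = Γ'.bit d :: (u.map Γ'.bit ++ rest) := by simp
    refine (SegRuns.cons hk hbody ih).cast (by simp) (by simp) (by simp) ?_
    simp only [List.length_cons]; omega

/-- **One literal** `(x, p)`: its annotated word goes (reversed) to the output. [folklore] -/
theorem segRuns_ac_literal (x : ℕ) (p : Bool) (hx : x ∈ occList F) (ac2 rest : List Γ') :
    SegRuns (kr KR.fam2) acBody (KCNF.encodeLiteral (x, p)) (aSt S (KCNF.encodeLiteral (x, p) ++ rest) [] [] ac2 [] [])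
      (aSt S rest [] [] ((wALit (annLit P F (x, p))).reverse ++ ac2) [] [])
      (aK Lo (wRecs (dictRecs P F (occList F))).length (bsz P) * (KCNF.encodeLiteral (x, p)).length) := by
  have hlit : KCNF.encodeLiteral (x, p) = Γ'.bit p :: ((encodeNat x).map Γ'.bit ++ [Γ'.comma]) := rfl
  rw [hlit, ← bit_cons_dpay]
  set bs := (encodeNat x).map Γ'.bit with hbs
  have h1 : Runs (acBody (Γ'.bit p)) (Function.update (aSt S (Γ'.bit p :: (bs ++ [Γ'.comma]) ++ rest) [] [] ac2 [] []) (kr KR.fam2) (bs ++ [Γ'.comma] ++ rest))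
      (aSt S (bs ++ [Γ'.comma] ++ rest) [Γ'.blank] [] (Γ'.bit p :: ac2) [] []) ((1 + 1) + 2) := by
    rw [update_aSt_fam2]; unfold acBody
    refine Runs.pop_nil (by simp) ?_
    exact (Runs.push' (R' := aSt S (bs ++ [Γ'.comma] ++ rest) [] [] (Γ'.bit p :: ac2) [] []) (by simp)).seq (Runs.push' (by simp))
  have h2 := segRuns_ac_bits S (Γ'.bit p :: ac2) (encodeNat x) ([Γ'.comma] ++ rest) []
  rw [← hbs] at h2
  simp only [List.append_nil] at h2
  have hrb : bs.reverse = rbits x := rfl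
  rw [hrb] at h2
  have h3 : Runs (acBody Γ'.comma) (Function.update (aSt S ([Γ'.comma] ++ rest) [Γ'.blank] (rbits x) (Γ'.bit p :: ac2) [] []) (kr KR.fam2) rest)
      (aSt S rest [] [] ((dpay P F x).reverse ++ Γ'.bit p :: ac2) [] []) (((12 * Lo + 44) * (wRecs (dictRecs P F (occList F))).length + 5 * Lo + 3 * bsz P + 20) + 2) := by
    rw [update_aSt_fam2]; unfold acBody
    refine Runs.pop_cons (k := kr KR.md) (a := Γ'.blank) (w := []) (by simp) ?_
    rw [update_aSt_md]
    exact runs_litAc S P F hA Lo hLo x hx rest (Γ'.bit p :: ac2)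
  have hk1 : aSt S (Γ'.bit p :: (bs ++ [Γ'.comma]) ++ rest) [] [] ac2 [] [] (kr KR.fam2) = Γ'.bit p :: (bs ++ [Γ'.comma] ++ rest) := by simp
  have hk3 : aSt S ([Γ'.comma] ++ rest) [Γ'.blank] (rbits x) (Γ'.bit p :: ac2) [] [] (kr KR.fam2) = Γ'.comma :: rest := by simp
  have h23 := h2.append (SegRuns.single hk3 h3)
  have := SegRuns.cons hk1 h1 (h23.cast rfl (by simp) rfl le_rfl)
  refine this.cast (by simp) rfl (by simp) ?_
  simp only [List.length_cons, List.length_append, List.length_nil, List.length_map, hbs, aK]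
  nlinarith [Nat.zero_le ((encodeNat x).length * (wRecs (dictRecs P F (occList F))).length), Nat.zero_le (Lo * (wRecs (dictRecs P F (occList F))).length)]

/-- **The literals of a clause.** [folklore] -/
theorem segRuns_ac_lits : ∀ (lits : List (ℕ × Bool)), (∀ l ∈ lits, l.1 ∈ occList F) → ∀ (ac2 rest : List Γ'),
    SegRuns (kr KR.fam2) acBody (cbody lits) (aSt S (cbody lits ++ rest) [] [] ac2 [] [])
      (aSt S rest [] [] (((lits.map (annLit P F)).flatMap wALit).reverse ++ ac2) [] [])
      (aK Lo (wRecs (dictRecs P F (occList F))).length (bsz P) * (cbody lits).length)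
  | [], _, ac2, rest => by simpa using SegRuns.nil (kr KR.fam2) acBody _
  | l :: lits, hl, ac2, rest => by
    have h1 := segRuns_ac_literal S P F hA Lo hLo l.1 l.2 (hl l (by simp)) ac2 (cbody lits ++ rest)
    have h2 := segRuns_ac_lits lits (fun l' h => hl l' (by simp [h])) ((wALit (annLit P F (l.1, l.2))).reverse ++ ac2) rest
    have := h1.append h2
    refine this.cast (by simp [cbody_cons, encodeLiteral_eq]) (by simp [cbody_cons, encodeLiteral_eq]) (by simp [List.reverse_append]) ?_
    simp only [cbody_cons, encodeLiteral_eq, List.length_append, List.length_cons, List.length_nil]; ring_nf; omega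

/-- **One clause**: its annotated word, closed by a blank. [folklore] -/
theorem segRuns_ac_clause (c : List (ℕ × Bool)) (hc : ∀ l ∈ c, l.1 ∈ occList F) (ac2 rest : List Γ') :
    SegRuns (kr KR.fam2) acBody (KCNF.encodeClause c) (aSt S (KCNF.encodeClause c ++ rest) [] [] ac2 [] [])
      (aSt S rest [] [] ((wAClause P F c).reverse ++ ac2) [] []) (aK Lo (wRecs (dictRecs P F (occList F))).length (bsz P) * (KCNF.encodeClause c).length) := by
  have hw : KCNF.encodeClause c = Γ'.bra :: (cbody c ++ [Γ'.ket]) := by simp [KCNF.encodeClause, cbody]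
  rw [hw]
  have h0 : Runs (acBody Γ'.bra) (Function.update (aSt S (Γ'.bra :: (cbody c ++ [Γ'.ket]) ++ rest) [] [] ac2 [] []) (kr KR.fam2) (cbody c ++ [Γ'.ket] ++ rest))
      (aSt S (cbody c ++ [Γ'.ket] ++ rest) [] [] ac2 [] []) (0 + 2) := by
    rw [update_aSt_fam2]; unfold acBody
    exact Runs.pop_nil (by simp) ((Runs.skip _).of_eq (by simp) le_rfl)
  have hk0 : aSt S (Γ'.bra :: (cbody c ++ [Γ'.ket]) ++ rest) [] [] ac2 [] [] (kr KR.fam2) = Γ'.bra :: (cbody c ++ [Γ'.ket] ++ rest) := by simp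
  have h1 := segRuns_ac_lits S P F hA Lo hLo c hc ac2 ([Γ'.ket] ++ rest)
  have h2 : Runs (acBody Γ'.ket) (Function.update (aSt S ([Γ'.ket] ++ rest) [] [] (((c.map (annLit P F)).flatMap wALit).reverse ++ ac2) [] []) (kr KR.fam2) rest)
      (aSt S rest [] [] ((wAClause P F c).reverse ++ ac2) [] []) (1 + 2) := by
    rw [update_aSt_fam2]; unfold acBody
    refine Runs.pop_nil (by simp) (Runs.push' ?_)
    rw [aSt_ac2, update_aSt_ac2]; simp [wAClause]
  have hk2 : aSt S ([Γ'.ket] ++ rest) [] [] (((c.map (annLit P F)).flatMap wALit).reverse ++ ac2) [] [] (kr KR.fam2) = Γ'.ket :: rest := by simp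
  have := SegRuns.cons hk0 h0 ((h1.append (SegRuns.single hk2 h2)).cast rfl (by simp) rfl le_rfl)
  refine this.cast rfl rfl rfl ?_
  simp only [List.length_cons, List.length_append, List.length_nil, aK]; nlinarith

/-- **The clauses.** [folklore] -/
theorem segRuns_ac_clauses : ∀ (G : List (List (ℕ × Bool))), (∀ c ∈ G, ∀ l ∈ c, l.1 ∈ occList F) → ∀ (ac2 rest : List Γ'),
    SegRuns (kr KR.fam2) acBody (wFam G) (aSt S (wFam G ++ rest) [] [] ac2 [] [])
      (aSt S rest [] [] ((G.flatMap (wAClause P F)).reverse ++ ac2) [] []) (aK Lo (wRecs (dictRecs P F (occList F))).length (bsz P) * (wFam G).length)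
  | [], _, ac2, rest => by simpa [wFam] using SegRuns.nil (kr KR.fam2) acBody _
  | c :: G, hG, ac2, rest => by
    have h1 := segRuns_ac_clause S P F hA Lo hLo c (hG c (by simp)) ac2 (wFam G ++ rest)
    have h2 := segRuns_ac_clauses G (fun c' h => hG c' (by simp [h])) ((wAClause P F c).reverse ++ ac2) rest
    have := h1.append h2
    have hwc : wFam (c :: G) = KCNF.encodeClause c ++ wFam G := by rw [wFam_cons]; simp [KCNF.encodeClause, cbody]
    refine this.cast hwc.symm (by rw [hwc, List.append_assoc]) (by simp [List.reverse_append]) ?_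
    rw [hwc, List.length_append]; ring_nf; omega

/-- **Specification of `acBuild`.** [folklore] -/
theorem runs_acBuild (hfam2 : S (kr KR.fam2) = []) (hmd : S (kr KR.md) = []) (hpr : S (kr KR.pr) = []) (hac2 : S (kr KR.ac2) = [])
    (hfnd : S (kr KR.fnd) = []) (hkey : S (kr KR.key) = []) (hac : S (kr KR.ac) = []) :
    Runs acBuild S (Function.update S (kr KR.ac) (wAC P F))
      ((aK Lo (wRecs (dictRecs P F (occList F))).length (bsz P) + 10) * (wFam F).length + 3 * (wAC P F).length + 5) := by
  have e0 : aSt S [] [] [] [] [] [] = S := by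
    have e := aSt_eta S
    rw [hfam2, hmd, hpr, hac2, hfnd, hkey] at e; exact e
  have hF : ∀ c ∈ F, ∀ l ∈ c, l.1 ∈ occList F := fun c hc l hl =>
    mem_occList.2 (mem_occVars.2 ⟨c, hc, occursIn_eq_true.2 ⟨l, hl, rfl⟩⟩)
  unfold acBuild
  have h0 := runs_copyToG (a := kr KR.fam) (b := kr KR.fam2) (t₁ := kr KR.t1) (t₂ := kr KR.t2)
    (by simp) (by simp) (by simp) (by simp) (by simp) (by simp) (aSt S [] [] [] [] [] []) (by simp [hA.t1]) (by simp [hA.t2]) (by simp)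
  rw [aSt_fam, hA.fam, update_aSt_fam2] at h0
  have h1 := (segRuns_ac_clauses S P F hA Lo hLo F hF [] []).runs_loop_nil (by simp)
  simp only [List.append_nil] at h1
  have h2 := runs_pour (a := kr KR.ac2) (b := kr KR.ac) (by simp) (aSt S [] [] [] (F.flatMap (wAClause P F)).reverse [] [])
  rw [aSt_ac2, aSt_ac, hac, List.append_nil, List.reverse_reverse, List.length_reverse, update_aSt_ac2] at h2
  rw [e0] at h0
  refine (h0.seq (h1.seq h2)).of_eq ?_ ?_
  · rw [e0, wAC]
  · rw [← wAC]; nlinarith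

end AcSpec

end Literature.Computability.FineGrained.IPRenameM
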